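import Literature.AnabelianGeometry.AbsoluteAnabelian.AbsTopIII.ReconstructionCor110ibNaturalFundProofs
import Literature.NumberTheory.GaloisRepresentations.PowCompletionEtaRigidity
import HarnessLib

/-!
# [AbsTopIII] Cor. 1.10 (i)(b) PINNED on THE reciprocity map — UNIQUENESS of the family

Mochizuki, *Topics in Absolute Anabelian Geometry III*, Cor. 1.10 (i)(b) p. 42 («one constructs the
surjection `H¹(G_k, μ_Ẑ(G_k)) ⥲ G_k^ab ↠ G_k^unr ⥲ Ẑ`»; statement p. 41: «the natural surjection
`H¹(G_k, μ_Ẑ(G_k)) ⥲ G_k^ab ↠ Ẑ`» — the isomorphism `j_k : H¹(G_k, μ_Ẑ(G_k)) ⥲ G_k^ab` treated here is the FIRST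
ARROW of that display).  PROOF-ONLY companion (abc-iut layer L4, abc-iut-L4-d3, item «UNIQ-B») of
`ReconstructionCor110ibNaturalFund.lean`: clause (1♯) ALONE — `j_k ∘ H¹(i_k^fund)⁻¹ ∘ κ̂ = θ_k`, agreement with
THE canonical reciprocity map on the Kummer image of `kˣ` — determines `j_k : H¹(G_k, μ_Ẑ(G_k)) ≃+ G_k^ab`
(`Cor_1_10_i_b_natural_fund.eq_of_clause_one`), with NO continuity assumption on `j_k`: transported along
abc-iut-L4-t11's Kummer–completion isomorphism `K : H¹(G_k, μ_Ẑ(G_k)) ≃ (kˣ)^∧` (which carries the Kummer class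
of `u` to `η(u)`, `Cor110iiPrime.continuousCohomologyOneTateModuleEquivCompletion_kummerTate`), the automorphism
`j⁻¹ ∘ j′` becomes an endomorphism of the profinite completion `(kˣ)^∧` fixing `η(kˣ)`, hence the identity by the
rigidity of `(kˣ)^∧` (`PowCompletion.eq_of_forall_map_eta_eq`: `kˣ/(kˣ)ⁿ` finite, `η(kˣ)·((kˣ)^∧)ⁿ = (kˣ)^∧`, no
divisible elements).  Whence every witness family of `Cor_1_10_i_b_natural_fund` IS THE family of
`cor_1_10_i_b_natural_fund_holds` — the first arrow of (b) is ONE DEFINITE isomorphism with no hidden choice,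
exactly as (a)'s «the natural isomorphism» `H²(G_k, μ_Ẑ(G_k)) ⥲ Ẑ`
(`Cor_1_10_i_a_natural_fund.eq_of_clause_one`).  Theorems only; axioms standard.  HONEST FRAMING: classical local
class field theory and Kummer theory; nothing here bears on [IUTchIII] Cor. 3.12 or takes a side.
-/

noncomputable section

open CategoryTheory Function
open Field IsNonarchimedeanLocalField ValuativeRel
open ProfiniteGrp ProfiniteGrp.ProfiniteCompletion

namespace Literature.AnabelianGeometry.AbsoluteAnabelian

open _root_.TopRep _root_.ContRepresentation _root_.ContinuousCohomology
open Literature.NumberTheory.GaloisRepresentations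
open Literature.NumberTheory.GaloisRepresentations.LocalWeilDatum

namespace Cor110iiPrime

variable (k : Type) [Field k] [CharZero k]
  (hfin : ∀ n : ℕ+, ((powMonoidHom (n : ℕ) : kˣ →* kˣ).range).FiniteIndex)
  (φ : muQZ (absoluteGaloisGroup k) ≃+ Additive (CommGroup.torsion (AlgebraicClosure k)ˣ))
  (hφ : ∀ (σ : absoluteGaloisGroup k) (x : muQZ (absoluteGaloisGroup k)),
      (((Additive.toMul (φ (σ • x)) : CommGroup.torsion (AlgebraicClosure k)ˣ) :
          (AlgebraicClosure k)ˣ) : AlgebraicClosure k) =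
        σ • (((Additive.toMul (φ x) : CommGroup.torsion (AlgebraicClosure k)ˣ) :
          (AlgebraicClosure k)ˣ) : AlgebraicClosure k))

/-- Unfolding `reciprocityOfContainerIso` on an element: `j (H¹(i)⁻¹ (κ̂ u))`.
[cite: MochizukiAbsTopIII2015, Cor 1.10 (ii) p.42] -/
theorem reciprocityOfContainerIso_apply
    (j : galCyclotomeH1 (absoluteGaloisGroup k) ≃+ Additive (absoluteGaloisGroupAbelianization k)) (u : kˣ) :
    reciprocityOfContainerIso hφ j u = Additive.toMul (j ((cohomologyMap (galCyclotomeIsoTateModule k φ hφ).inv 1).hom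
      (Multiplicative.toAdd (kummerTate k u)))) := rfl

/-- **The Kummer–completion isomorphism `K = (H¹(i) ≫ (H¹(G_k, Ẑ(1)) ≃ (kˣ)^∧))` carries the Kummer class of
`u` in the real container to `η(u)`.** [cite: MochizukiAbsTopIII2015, Cor 1.10 (ii) p.42] -/
theorem kummerCompletion_symm_eta (u : kˣ) :
    ((AddEquiv.mk' (continuousCohomologyEquivOfIso (galCyclotomeIsoTateModule k φ hφ) 1)
          fun x y => map_add (cohomologyMap (galCyclotomeIsoTateModule k φ hφ).hom 1).hom x y).trans
        (continuousCohomologyOneTateModuleEquivCompletion k hfin)).symm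
      (Additive.ofMul ((eta (GrpCat.of kˣ)).hom u)) =
    (cohomologyMap (galCyclotomeIsoTateModule k φ hφ).inv 1).hom (Multiplicative.toAdd (kummerTate k u)) := by
  apply ((AddEquiv.mk' (continuousCohomologyEquivOfIso (galCyclotomeIsoTateModule k φ hφ) 1)
      fun x y => map_add (cohomologyMap (galCyclotomeIsoTateModule k φ hφ).hom 1).hom x y).trans
    (continuousCohomologyOneTateModuleEquivCompletion k hfin)).injective
  rw [AddEquiv.apply_symm_apply]
  change _ = continuousCohomologyOneTateModuleEquivCompletion k hfin
    ((cohomologyMap (galCyclotomeIsoTateModule k φ hφ).hom 1).hom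
      ((cohomologyMap (galCyclotomeIsoTateModule k φ hφ).inv 1).hom (Multiplicative.toAdd (kummerTate k u))))
  rw [show (cohomologyMap (galCyclotomeIsoTateModule k φ hφ).hom 1).hom
      ((cohomologyMap (galCyclotomeIsoTateModule k φ hφ).inv 1).hom (Multiplicative.toAdd (kummerTate k u))) =
      Multiplicative.toAdd (kummerTate k u) from
    cohomologyMap_inv_hom_apply (galCyclotomeIsoTateModule k φ hφ).symm 1 _,
    continuousCohomologyOneTateModuleEquivCompletion_kummerTate]

end Cor110iiPrime

namespace AbsTopIII

/-- **UNIQUENESS of the (b) isomorphism from clause (1♯) alone.**  Two families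
`j, j′ : H¹(G_k, μ_Ẑ(G_k)) ≃+ G_k^ab` which both send the Kummer class of every `u ∈ kˣ` (through THE
fundamental identification) to `θ_k(u)` coincide — with NO continuity assumption: `j⁻¹ ∘ j′`, read on the
profinite completion `(kˣ)^∧` through the Kummer–completion isomorphism, is an endomorphism fixing `η(kˣ)`,
hence the identity (`PowCompletion.eq_of_forall_map_eta_eq`).
[cite: MochizukiAbsTopIII2015, Cor 1.10 (i) p.42] [cite: RibesZalesskii2010, §3.2] -/
theorem Cor_1_10_i_b_natural_fund.eq_of_clause_one
    (j j' : ∀ (k : Type) [Field k] [ValuativeRel k] [TopologicalSpace k] [IsNonarchimedeanLocalField k]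
      [CharZero k],
      galCyclotomeH1 (absoluteGaloisGroup k) ≃+ Additive (absoluteGaloisGroupAbelianization k))
    (hj : ∀ (k : Type) [Field k] [ValuativeRel k] [TopologicalSpace k] [IsNonarchimedeanLocalField k]
      [CharZero k] [ValuativeExtension k k] (u : kˣ),
      reciprocityOfContainerIso (TorsionReciprocityData.fundamental k).equiv_smul (j k) u =
        (isReciprocitySystemE (F := k) (E := k) (isClassFieldTheory_localWeilDatum k)).theta u)
    (hj' : ∀ (k : Type) [Field k] [ValuativeRel k] [TopologicalSpace k] [IsNonarchimedeanLocalField k]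
      [CharZero k] [ValuativeExtension k k] (u : kˣ),
      reciprocityOfContainerIso (TorsionReciprocityData.fundamental k).equiv_smul (j' k) u =
        (isReciprocitySystemE (F := k) (E := k) (isClassFieldTheory_localWeilDatum k)).theta u)
    (k : Type) [Field k] [ValuativeRel k] [TopologicalSpace k] [IsNonarchimedeanLocalField k] [CharZero k]
    (x : galCyclotomeH1 (absoluteGaloisGroup k)) : j k x = j' k x := by
  classical
  haveI : ValuativeExtension k k := ⟨fun _ _ => Iff.rfl⟩
  set hfin := Cor110iiPrime.finiteIndex_range_powMonoidHom k
  set T := TorsionReciprocityData.fundamental k with hT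
  -- the Kummer–completion isomorphism `K : H¹(G_k, μ_Ẑ(G_k)) ≃+ (kˣ)^∧`
  set K : galCyclotomeH1 (absoluteGaloisGroup k) ≃+ Additive (completion (GrpCat.of kˣ)) :=
    (AddEquiv.mk' (continuousCohomologyEquivOfIso (galCyclotomeIsoTateModule k T.equiv T.equiv_smul) 1)
        fun x y => map_add (cohomologyMap (galCyclotomeIsoTateModule k T.equiv T.equiv_smul).hom 1).hom x y).trans
      (continuousCohomologyOneTateModuleEquivCompletion k hfin) with hK
  -- the endomorphism `h = K ∘ j⁻¹ ∘ j′ ∘ K⁻¹` of `(kˣ)^∧`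
  set g : Additive (completion (GrpCat.of kˣ)) ≃+ Additive (completion (GrpCat.of kˣ)) :=
    K.symm.trans (((j' k).trans (j k).symm).trans K) with hg
  set h : completion (GrpCat.of kˣ) →* completion (GrpCat.of kˣ) :=
    (AddEquiv.toMultiplicative g).toMonoidHom with hh
  -- `h` fixes `η(kˣ)`: both `j` and `j′` send the Kummer class of `u` to `θ_k(u)`
  have hη : ∀ u : kˣ, h (etaFn (GrpCat.of kˣ) u) = etaFn (GrpCat.of kˣ) u := by
    intro u
    have h1 := hj k u
    have h2 := hj' k u
    rw [Cor110iiPrime.reciprocityOfContainerIso_apply] at h1 h2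
    have h12 : j' k ((cohomologyMap (galCyclotomeIsoTateModule k T.equiv T.equiv_smul).inv 1).hom
        (Multiplicative.toAdd (kummerTate k u))) =
        j k ((cohomologyMap (galCyclotomeIsoTateModule k T.equiv T.equiv_smul).inv 1).hom
          (Multiplicative.toAdd (kummerTate k u))) :=
      Additive.toMul.injective (h2.trans h1.symm)
    have hKu : K.symm (Additive.ofMul (etaFn (GrpCat.of kˣ) u)) =
        (cohomologyMap (galCyclotomeIsoTateModule k T.equiv T.equiv_smul).inv 1).hom
          (Multiplicative.toAdd (kummerTate k u)) :=
      Cor110iiPrime.kummerCompletion_symm_eta k hfin T.equiv T.equiv_smul u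
    change Additive.toMul (K ((j k).symm (j' k (K.symm (Additive.ofMul (etaFn (GrpCat.of kˣ) u)))))) = _
    rw [hKu, h12, AddEquiv.symm_apply_apply, ← hKu, AddEquiv.apply_symm_apply]
    rfl
  -- rigidity: `h = id`, i.e. `g = id`, i.e. `j = j′`
  have hid : ∀ y, h y = y := PowCompletion.eq_of_forall_map_eta_eq hfin h hη
  have hgK : g (K x) = K x := by
    have := hid (Additive.toMul (K x))
    exact congrArg Additive.ofMul this
  have h3 : (j k).symm (j' k x) = x := by
    have h4 : K ((j k).symm (j' k (K.symm (K x)))) = K x := hgK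
    rw [AddEquiv.symm_apply_apply] at h4
    exact K.injective h4
  have h5 := congrArg (j k) h3
  rw [AddEquiv.apply_symm_apply] at h5
  exact h5.symm

/-- **Every witness family of the pinned (b) Prop IS THE family of `cor_1_10_i_b_natural_fund_holds`**: for any
two witness families `j, j′` of `Cor_1_10_i_b_natural_fund`, `j_k = j′_k` for every MLF `k`.
[cite: MochizukiAbsTopIII2015, Cor 1.10 (i) p.42] -/
theorem Cor_1_10_i_b_natural_fund.witness_unique
    (j j' : ∀ (k : Type) [Field k] [ValuativeRel k] [TopologicalSpace k] [IsNonarchimedeanLocalField k]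
      [CharZero k],
      galCyclotomeH1 (absoluteGaloisGroup k) ≃+ Additive (absoluteGaloisGroupAbelianization k))
    (hj : (∀ (k : Type) [Field k] [ValuativeRel k] [TopologicalSpace k] [IsNonarchimedeanLocalField k]
        [CharZero k] [ValuativeExtension k k] (u : kˣ),
        reciprocityOfContainerIso (TorsionReciprocityData.fundamental k).equiv_smul (j k) u =
          (isReciprocitySystemE (F := k) (E := k) (isClassFieldTheory_localWeilDatum k)).theta u) ∧
      (∀ (k₁ : Type) [Field k₁] [ValuativeRel k₁] [TopologicalSpace k₁] [IsNonarchimedeanLocalField k₁]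
        [CharZero k₁]
        (k₂ : Type) [Field k₂] [ValuativeRel k₂] [TopologicalSpace k₂] [IsNonarchimedeanLocalField k₂]
        [CharZero k₂]
        (α : absoluteGaloisGroup k₁ ≃ₜ* absoluteGaloisGroup k₂) (x : galCyclotomeH1 (absoluteGaloisGroup k₁)),
        j k₂ (galCyclotomeH1Map α x) = Additive.ofMul (abelianizationCongr α (Additive.toMul (j k₁ x)))) ∧
      ∀ (k : Type) [Field k] [ValuativeRel k] [TopologicalSpace k] [IsNonarchimedeanLocalField k] [CharZero k]
        (k' : Type) [Field k'] [ValuativeRel k'] [TopologicalSpace k'] [IsNonarchimedeanLocalField k']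
        [CharZero k'] [Algebra k k'] [FiniteDimensional k k'] (x : galCyclotomeH1 (absoluteGaloisGroup k)),
        j k' ((galCyclotomeRes k k' 1).hom x) =
          Additive.ofMul (Literature.NumberTheory.GaloisRepresentations.verlagerung k k' (Additive.toMul (j k x))))
    (hj' : (∀ (k : Type) [Field k] [ValuativeRel k] [TopologicalSpace k] [IsNonarchimedeanLocalField k]
        [CharZero k] [ValuativeExtension k k] (u : kˣ),
        reciprocityOfContainerIso (TorsionReciprocityData.fundamental k).equiv_smul (j' k) u =
          (isReciprocitySystemE (F := k) (E := k) (isClassFieldTheory_localWeilDatum k)).theta u) ∧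
      (∀ (k₁ : Type) [Field k₁] [ValuativeRel k₁] [TopologicalSpace k₁] [IsNonarchimedeanLocalField k₁]
        [CharZero k₁]
        (k₂ : Type) [Field k₂] [ValuativeRel k₂] [TopologicalSpace k₂] [IsNonarchimedeanLocalField k₂]
        [CharZero k₂]
        (α : absoluteGaloisGroup k₁ ≃ₜ* absoluteGaloisGroup k₂) (x : galCyclotomeH1 (absoluteGaloisGroup k₁)),
        j' k₂ (galCyclotomeH1Map α x) = Additive.ofMul (abelianizationCongr α (Additive.toMul (j' k₁ x)))) ∧
      ∀ (k : Type) [Field k] [ValuativeRel k] [TopologicalSpace k] [IsNonarchimedeanLocalField k] [CharZero k]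
        (k' : Type) [Field k'] [ValuativeRel k'] [TopologicalSpace k'] [IsNonarchimedeanLocalField k']
        [CharZero k'] [Algebra k k'] [FiniteDimensional k k'] (x : galCyclotomeH1 (absoluteGaloisGroup k)),
        j' k' ((galCyclotomeRes k k' 1).hom x) =
          Additive.ofMul (Literature.NumberTheory.GaloisRepresentations.verlagerung k k' (Additive.toMul (j' k x))))
    (k : Type) [Field k] [ValuativeRel k] [TopologicalSpace k] [IsNonarchimedeanLocalField k] [CharZero k]
    (x : galCyclotomeH1 (absoluteGaloisGroup k)) : j k x = j' k x :=
  Cor_1_10_i_b_natural_fund.eq_of_clause_one j j' hj.1 hj'.1 k x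

end AbsTopIII

end Literature.AnabelianGeometry.AbsoluteAnabelian
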